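import Literature.Topology.FourManifolds.GluedDesc
import HarnessLib

/-!
# Smooth maps out of a glued space times a parameter manifold

General differential topology (topic `Literature/Topology/FourManifolds`, next to
`GluingConstruction.lean`, `GluedDesc.lean`; everything PROVED, no definitions).  The tube of the
genus-2 surface `Σ̄₂ ⊂ T⁴ # ℂℙ²bar` of Akhmedov–Park (Invent. Math. 181 (2010), §3) is a map out of
`F × ℝ²` where `F = T ∪_glue T′` is a glued space (`SmoothGlueData.Glued`); it is defined by
descending (`SmoothGlueData.desc`) a compatible pair of maps `A → (V → Z)`, `B → (V → Z)`, and its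
smoothness is checked on the two pieces.  This file records that criterion:

* `contMDiff_glued_prod_of_comp` — a map `G : d.Glued × V → Z` is smooth as soon as
  `(a, v) ↦ G (inl a, v)` and `(b, v) ↦ G (inr b, v)` are (the products `inl × id`, `inr × id` are open
  smooth embeddings covering `d.Glued × V`; `IsOpenGluing.contMDiff_of_comp_eq`);
* `contMDiffOn_glued_prod_of_comp` — the same on an open set `W ⊆ d.Glued × V` described by its two
  preimages;
* `desc_prod_apply_inl/inr` — evaluation of the descended family.

## References

* A. Kosinski, *Differential Manifolds*, Academic Press (1993), Ch. VI §1. [Kosinski1993]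
-/

noncomputable section

open scoped Manifold ContDiff Topology
open Set Function

namespace Literature.Topology.FourManifolds

namespace SmoothGlueData

universe uA uB

variable {E_A H_A : Type*} [NormedAddCommGroup E_A] [NormedSpace ℝ E_A] [TopologicalSpace H_A]
  {E_B H_B : Type*} [NormedAddCommGroup E_B] [NormedSpace ℝ E_B] [TopologicalSpace H_B]
  {I_A : ModelWithCorners ℝ E_A H_A} {I_B : ModelWithCorners ℝ E_B H_B}
  [I_A.Boundaryless] [I_B.Boundaryless]
  {A : Type uA} [TopologicalSpace A] [ChartedSpace H_A A] [IsManifold I_A ∞ A]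
  {B : Type uB} [TopologicalSpace B] [ChartedSpace H_B B] [IsManifold I_B ∞ B]
  {E_P : Type*} [NormedAddCommGroup E_P] [NormedSpace ℝ E_P]
  (d : SmoothGlueData I_A I_B A B E_P)
  {E_V : Type*} [NormedAddCommGroup E_V] [NormedSpace ℝ E_V] {H_V : Type*} [TopologicalSpace H_V]
  {I_V : ModelWithCorners ℝ E_V H_V}
  {V : Type*} [TopologicalSpace V] [ChartedSpace H_V V] [IsManifold I_V ∞ V]
  {E_Z : Type*} [NormedAddCommGroup E_Z] [NormedSpace ℝ E_Z] {H_Z : Type*} [TopologicalSpace H_Z]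
  {I_Z : ModelWithCorners ℝ E_Z H_Z}
  {Z : Type*} [TopologicalSpace Z] [ChartedSpace H_Z Z] [IsManifold I_Z ∞ Z]

/-- `inl × id` and `inr × id` are open smooth embeddings covering `d.Glued × V`. [cite: Kosinski1993, Ch. VI §1] -/
theorem isOpenGluing_prod :
    Manifold.IsSmoothEmbedding (I_A.prod I_V) ((𝓘(ℝ, E_P)).prod I_V) ∞ (Prod.map d.inl (id : V → V)) ∧
    IsOpen (range (Prod.map d.inl (id : V → V))) ∧
    Manifold.IsSmoothEmbedding (I_B.prod I_V) ((𝓘(ℝ, E_P)).prod I_V) ∞ (Prod.map d.inr (id : V → V)) ∧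
    IsOpen (range (Prod.map d.inr (id : V → V))) ∧
    range (Prod.map d.inl (id : V → V)) ∪ range (Prod.map d.inr (id : V → V)) = univ := by
  refine ⟨d.isSmoothEmbedding_inl.prodMap Manifold.IsSmoothEmbedding.id, ?_,
    d.isSmoothEmbedding_inr.prodMap Manifold.IsSmoothEmbedding.id, ?_, ?_⟩
  · rw [range_prodMap, range_id]; exact d.isOpen_range_inl.prod isOpen_univ
  · rw [range_prodMap, range_id]; exact d.isOpen_range_inr.prod isOpen_univ
  · rw [range_prodMap, range_prodMap, range_id, eq_univ_iff_forall]
    rintro ⟨p, v⟩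
    rcases d.exists_inl_or_inr p with ⟨a, rfl⟩ | ⟨b, rfl⟩
    · exact Or.inl ⟨⟨a, rfl⟩, mem_univ v⟩
    · exact Or.inr ⟨⟨b, rfl⟩, mem_univ v⟩

/-- **Smoothness on the glued product is checked on the pieces.** [cite: Kosinski1993, Ch. VI §1, proof of Thm (1.1)] -/
theorem contMDiff_glued_prod_of_comp {G : d.Glued × V → Z}
    (hA : ContMDiff (I_A.prod I_V) I_Z ∞ fun q : A × V => G (d.inl q.1, q.2))
    (hB : ContMDiff (I_B.prod I_V) I_Z ∞ fun q : B × V => G (d.inr q.1, q.2)) :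
    ContMDiff ((𝓘(ℝ, E_P)).prod I_V) I_Z ∞ G := by
  obtain ⟨h1, h2, h3, h4, -⟩ := d.isOpenGluing_prod (I_V := I_V) (V := V)
  rintro ⟨p, v⟩
  rcases d.exists_inl_or_inr p with ⟨a, rfl⟩ | ⟨b, rfl⟩
  · exact contMDiffAt_of_comp_isImmersionAt (j := Prod.map d.inl (id : V → V)) (a := (a, v))
      (g := fun q : A × V => G (d.inl q.1, q.2)) (h1.isImmersion.isImmersionAt (a, v))
      (Topology.IsOpenEmbedding.isOpenMap ⟨h1.isEmbedding, h2⟩) (hA (a, v)) (fun _ => rfl)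
  · exact contMDiffAt_of_comp_isImmersionAt (j := Prod.map d.inr (id : V → V)) (a := (b, v))
      (g := fun q : B × V => G (d.inr q.1, q.2)) (h3.isImmersion.isImmersionAt (b, v))
      (Topology.IsOpenEmbedding.isOpenMap ⟨h3.isEmbedding, h4⟩) (hB (b, v)) (fun _ => rfl)

/-- **Smoothness on an open subset of the glued product is checked on the pieces**: if
`(a, v) ↦ G (inl a, v)` is smooth on the preimage of the open `W` and similarly for `inr`, then `G`
is smooth on `W`. [cite: Kosinski1993, Ch. VI §1] -/
theorem contMDiffOn_glued_prod_of_comp {G : d.Glued × V → Z} {W : Set (d.Glued × V)} (hW : IsOpen W)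
    (hA : ContMDiffOn (I_A.prod I_V) I_Z ∞ (fun q : A × V => G (d.inl q.1, q.2))
      ((fun q : A × V => (d.inl q.1, q.2)) ⁻¹' W))
    (hB : ContMDiffOn (I_B.prod I_V) I_Z ∞ (fun q : B × V => G (d.inr q.1, q.2))
      ((fun q : B × V => (d.inr q.1, q.2)) ⁻¹' W)) :
    ContMDiffOn ((𝓘(ℝ, E_P)).prod I_V) I_Z ∞ G W := by
  obtain ⟨h1, h2, h3, h4, -⟩ := d.isOpenGluing_prod (I_V := I_V) (V := V)
  rintro ⟨p, v⟩ hpv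
  apply ContMDiffAt.contMDiffWithinAt
  rcases d.exists_inl_or_inr p with ⟨a, rfl⟩ | ⟨b, rfl⟩
  · have hopen : IsOpen ((fun q : A × V => (d.inl q.1, q.2)) ⁻¹' W) :=
      hW.preimage ((d.continuous_inl.comp continuous_fst).prodMk continuous_snd)
    have hat : ContMDiffAt (I_A.prod I_V) I_Z ∞ (fun q : A × V => G (d.inl q.1, q.2)) (a, v) :=
      (hA _ hpv).contMDiffAt (hopen.mem_nhds hpv)
    exact contMDiffAt_of_comp_isImmersionAt (j := Prod.map d.inl (id : V → V)) (a := (a, v))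
      (g := fun q : A × V => G (d.inl q.1, q.2)) (h1.isImmersion.isImmersionAt (a, v))
      (Topology.IsOpenEmbedding.isOpenMap ⟨h1.isEmbedding, h2⟩) hat (fun _ => rfl)
  · have hopen : IsOpen ((fun q : B × V => (d.inr q.1, q.2)) ⁻¹' W) :=
      hW.preimage ((d.continuous_inr.comp continuous_fst).prodMk continuous_snd)
    have hat : ContMDiffAt (I_B.prod I_V) I_Z ∞ (fun q : B × V => G (d.inr q.1, q.2)) (b, v) :=
      (hB _ hpv).contMDiffAt (hopen.mem_nhds hpv)
    exact contMDiffAt_of_comp_isImmersionAt (j := Prod.map d.inr (id : V → V)) (a := (b, v))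
      (g := fun q : B × V => G (d.inr q.1, q.2)) (h3.isImmersion.isImmersionAt (b, v))
      (Topology.IsOpenEmbedding.isOpenMap ⟨h3.isEmbedding, h4⟩) hat (fun _ => rfl)

omit [I_A.Boundaryless] [I_B.Boundaryless] [IsManifold I_A ∞ A] [IsManifold I_B ∞ B]
  [TopologicalSpace V] in
/-- Evaluation of a descended family of maps on the first piece. [folklore] -/
theorem desc_prod_apply_inl {W : Type*} {FA : A → V → W} {FB : B → V → W}
    (h : ∀ a, a ∈ d.glue.source → FA a = FB (d.glue a)) (a : A) (v : V) :
    d.desc FA FB h (d.inl a) v = FA a v := by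
  rw [d.desc_inl]

omit [I_A.Boundaryless] [I_B.Boundaryless] [IsManifold I_A ∞ A] [IsManifold I_B ∞ B]
  [TopologicalSpace V] in
/-- Evaluation of a descended family of maps on the second piece. [folklore] -/
theorem desc_prod_apply_inr {W : Type*} {FA : A → V → W} {FB : B → V → W}
    (h : ∀ a, a ∈ d.glue.source → FA a = FB (d.glue a)) (b : B) (v : V) :
    d.desc FA FB h (d.inr b) v = FB b v := by
  rw [d.desc_inr]

end SmoothGlueData

end Literature.Topology.FourManifolds
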